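import Literature.MathematicalPhysics.QuantumFieldTheory.Balaban1983to89.B5Prop11Plancherel

/-!
# `Balaban1983to89.B5Eq129FreeResolventWeightedMarginal` — T. Bałaban, *Propagators and renormalization transformations for lattice gauge
# theories. I*, Commun. Math. Phys. **95** (1984) 17–40 [Balaban1984PropagatorsI] (1.29) p. 23, p. 36 (exponential weights): **THE TRANSVERSELY
# WEIGHTED FIBRE SUMS OF THE FREE RESOLVENT KERNEL ON `Π_μ ℤ∕N_μ` ARE SUBSOLUTIONS ON THE CYCLE `ℤ∕N_ν` AT THE SHIFTED MASS —
# `h(s) = Σ_{x_ν = s} Φ(x)k(x)`, `Φ` independent of `x_ν` with transverse supersolution defect `C`: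
# `t²[(h(s) − h(s−1)) + (h(s) − h(s+1))] + (m − C)·h(s) ≤ Φ(0)·δ_{s,0}`** — the transverse-decay input of the WEIGHTED ∇-row (P-J-1b) of the pub-balaban
# NE9 chain's storey J (row L13; t4-ne9-idea-1 g129's `weighted_marginal_subsolution` with an abstract coupling, Mathlib-only scratch under FREEZE (0) —
# here on UNEQUAL periods in the tree's (FS) `t²`-encoding); with `B5Eq129FreeResolventCycleComparison.cycle_le_mul_of_subsolution` and
# `B5Eq129FreeResolventCycleProfile.cycle_profile_eq` it gives `h ≤ Φ(0)·φ_{m−C}` in closed form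

statement-level skeleton of published theorems with citation tags; proofs where landed; nothing here is a claim about the Yang–Mills mass gap

CITATION HEADER (lean-in-tree rule).  Audit cell `pub-balaban`, sub-cell `t4`, BINDER row NE9; filed by NE9 crux-team LEAF PROVER 05
(`b2b-balaban-t4-ne9-formalise-leaf-05`, gen 80).  OBJECT: [Balaban1984PropagatorsI] (1.29) p. 23's free stencil in the encoding of the OWNER's
`B5Eq129FreeResolventSupBound` ∕ `B5Eq129CoshSupersolution` (`B5Prop11Plancherel.Tor N`, `unitVec`; resolvent equation, `k ≥ 0`, the weight's longitudinal
invariance and its TRANSVERSE supersolution bound as HYPOTHESES — for the product `cosh` weights without the `ν`-factor the bound holds with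
`C = 2t²Σ_{μ≠ν}(cosh a_μ − 1)` by the one-factor computation of `B5Eq129CoshSupersolution.weight_stencil'`; no `def`).  CONTENT: [folklore] (summation by parts
inside a fibre; one pairing).  Mathematics: t4-ne9-idea-1 g129 `t4/ideate/NE9/lens1-g129/lean/PJ1Bcycle_g129.NOT-TO-FILE.lean` l.1273–1340 (credit).
Nothing of [B5′] is asserted.

WHAT IS PROVED (sorry-free; proof lane — 0 `def`).
* **`fibre_sum_mul_transverse_comm`** (`μ ≠ ν`: the transverse stencil moves from `k` onto `Φ` inside the fibre `{x_ν = s}`).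
* **`weighted_fibreSum_subsolution`** — the displayed inequality; `wfibre_sub_unitVec` ∕ `wfibre_add_unitVec` (the shifted weighted fibre sums).
* §2 **`weighted_sum_abs_sub_eq`** — the WEIGHTED transverse collapse: one sign per fibre ⟹ `Σ_x w(x_ν)Φ(x)|k(x−e_ν) − k(x)| = Σ_s w(s)|h(s−1) − h(s)|`.
* §3 **`prod_weight_transverse_defect`**, `prod_weight_add_unitVec`, `prod_weight_reflect` — the ν-free product `Π_{μ≠ν}ψ_μ(x_μ)` of positive one-dimensional
  supersolution factors (`ψ(y+1) + ψ(y−1) ≤ 2cosh(a)ψ(y)`, e.g. `cosh(a·d_N(y))` by `B5G183FreeRowSum.cosh_circAbs_step`) satisfies the three weight hypotheses with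
  `C = 2t²Σ_{μ≠ν}(cosh a_μ − 1)`.
HONEST SCOPE.  Free (`U = 1`) scalar stencil; the weight is abstract (two displayed hypotheses); no closed form here.  ONE step of ONE letter of ONE un-opened
storey (J) of row L13; NOT the ∇-line of (3.42), NOT Tier P, NOT NE9 (cell pub-balaban: NE9 NOT PRINTED ∕ NOT PROVED; «NE9 ⇐ the named binders»; row WALLED
ON A MODEL (O-NE9-1; #5 UNRULED); spine PROVED 0∕9; rung (B)+1 finite T⁴ — NOT infinite volume, NOT mass gap, NOT BetaPertH, NOT Clay).  HONEST DEPENDENCY: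
continuum YM on T⁴ ⇐ BetaPertH ∧ nine spine estimates (0/9 proved); BetaPertH ⇐ (D1) ∧ (D4) ∧ CAP+tail; G-an2-4 gates asym, D1 and NE2/3/4.  NEW file
importing `B5Prop11Plancherel` only; nothing modified.  Net new unproved facts: 0.
-/

noncomputable section

open scoped BigOperators

namespace Literature.MathematicalPhysics.QuantumFieldTheory.Balaban1983to89.B5Eq129FreeResolventWeightedMarginal

open B5Prop11Plancherel (Tor unitVec)

variable {d : ℕ} (N : Fin d → ℕ)

/-- the ν-th coordinate of `x + e_ν`. [folklore] -/
private theorem add_unitVec_self (x : Tor N) (ν : Fin d) : (x + unitVec N ν) ν = x ν + 1 := by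
  simp [unitVec]

/-- the other coordinates of `x + e_ν`. [folklore] -/
private theorem add_unitVec_ne (x : Tor N) {ν μ : Fin d} (h : μ ≠ ν) : (x + unitVec N ν) μ = x μ := by
  simp [unitVec, Pi.single_eq_of_ne h]

/-- the ν-th coordinate of `x − e_ν`. [folklore] -/
private theorem sub_unitVec_self (x : Tor N) (ν : Fin d) : (x - unitVec N ν) ν = x ν - 1 := by
  simp [unitVec]

/-- the other coordinates of `x − e_ν`. [folklore] -/
private theorem sub_unitVec_ne (x : Tor N) {ν μ : Fin d} (h : μ ≠ ν) : (x - unitVec N ν) μ = x μ := by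
  simp [unitVec, Pi.single_eq_of_ne h]

/-- a weight invariant under the forward step in direction `ν` is invariant under the backward step. [folklore] -/
private theorem weight_sub_unitVec {Φ : Tor N → ℝ} {ν : Fin d} (hΦν : ∀ x, Φ (x + unitVec N ν) = Φ x) (x : Tor N) :
    Φ (x - unitVec N ν) = Φ x := by
  have := hΦν (x - unitVec N ν); rw [sub_add_cancel] at this; exact this.symm

variable [∀ μ, NeZero (N μ)]

/-- Weighted fibre sums of the longitudinal translate `k(· − e_ν)` are the shifted weighted fibre sums (`Φ` does not see `x_ν`). [folklore]
[cite: Balaban1984PropagatorsI, (1.29) p.23] -/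
theorem wfibre_sub_unitVec (k Φ : Tor N → ℝ) (ν : Fin d) (hΦν : ∀ x, Φ (x + unitVec N ν) = Φ x) (s : ZMod (N ν)) :
    ∑ x : Tor N, (if x ν = s then Φ x * k (x - unitVec N ν) else 0) = ∑ x : Tor N, (if x ν = s - 1 then Φ x * k x else 0) :=
  Fintype.sum_equiv (Equiv.subRight (unitVec N ν)) _ _ fun x => by
    simp only [Equiv.subRight_apply, sub_unitVec_self, sub_left_inj, weight_sub_unitVec N hΦν]

/-- Forward twin of `wfibre_sub_unitVec`. [folklore] [cite: Balaban1984PropagatorsI, (1.29) p.23] -/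
theorem wfibre_add_unitVec (k Φ : Tor N → ℝ) (ν : Fin d) (hΦν : ∀ x, Φ (x + unitVec N ν) = Φ x) (s : ZMod (N ν)) :
    ∑ x : Tor N, (if x ν = s then Φ x * k (x + unitVec N ν) else 0) = ∑ x : Tor N, (if x ν = s + 1 then Φ x * k x else 0) :=
  Fintype.sum_equiv (Equiv.addRight (unitVec N ν)) _ _ fun x => by
    simp only [Equiv.coe_addRight, add_unitVec_self, add_left_inj, hΦν]

/-- **TRANSVERSE SUMMATION BY PARTS INSIDE A FIBRE**: for `μ ≠ ν` the fibre `{x_ν = s}` is invariant under `± e_μ`, so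
`Σ_{x_ν = s} Φ(x)[(k x − k(x−e_μ)) + (k x − k(x+e_μ))] = Σ_{x_ν = s} k(x)[(Φ x − Φ(x−e_μ)) + (Φ x − Φ(x+e_μ))]`. [folklore]
[cite: Balaban1984PropagatorsI, (1.29) p.23] -/
theorem fibre_sum_mul_transverse_comm (k Φ : Tor N → ℝ) {ν μ : Fin d} (hμ : μ ≠ ν) (s : ZMod (N ν)) :
    ∑ x : Tor N, (if x ν = s then Φ x * ((k x - k (x - unitVec N μ)) + (k x - k (x + unitVec N μ))) else 0) =
      ∑ x : Tor N, (if x ν = s then k x * ((Φ x - Φ (x - unitVec N μ)) + (Φ x - Φ (x + unitVec N μ))) else 0) := by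
  have h1 : ∑ x : Tor N, (if x ν = s then Φ x * k (x - unitVec N μ) else 0) =
      ∑ x : Tor N, (if x ν = s then Φ (x + unitVec N μ) * k x else 0) :=
    Fintype.sum_equiv (Equiv.subRight (unitVec N μ)) _ _ fun x => by
      simp only [Equiv.subRight_apply, sub_unitVec_ne N x (Ne.symm hμ), sub_add_cancel]
  have h2 : ∑ x : Tor N, (if x ν = s then Φ x * k (x + unitVec N μ) else 0) =
      ∑ x : Tor N, (if x ν = s then Φ (x - unitVec N μ) * k x else 0) :=
    Fintype.sum_equiv (Equiv.addRight (unitVec N μ)) _ _ fun x => by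
      simp only [Equiv.coe_addRight, add_unitVec_ne N x (Ne.symm hμ), add_sub_cancel_right]
  have eL : ∀ x : Tor N, (if x ν = s then Φ x * ((k x - k (x - unitVec N μ)) + (k x - k (x + unitVec N μ))) else 0) =
      2 * (if x ν = s then Φ x * k x else 0) - (if x ν = s then Φ x * k (x - unitVec N μ) else 0) -
        (if x ν = s then Φ x * k (x + unitVec N μ) else 0) := fun x => by split_ifs <;> ring
  have eR : ∀ x : Tor N, (if x ν = s then k x * ((Φ x - Φ (x - unitVec N μ)) + (Φ x - Φ (x + unitVec N μ))) else 0) =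
      2 * (if x ν = s then Φ x * k x else 0) - (if x ν = s then Φ (x - unitVec N μ) * k x else 0) -
        (if x ν = s then Φ (x + unitVec N μ) * k x else 0) := fun x => by split_ifs <;> ring
  simp only [eL, eR, Finset.sum_sub_distrib, h1, h2]
  ring

/-- **THE TRANSVERSELY WEIGHTED FIBRE SUMS ARE SUBSOLUTIONS AT THE SHIFTED MASS.**  Let `k ≥ 0` solve `(L₀ + m)k = δ₀` on `Π_μ ℤ∕N_μ`, let the
weight `Φ` (no sign needed) NOT depend on `x_ν` (`Φ(x + e_ν) = Φ x`) and obey the TRANSVERSE supersolution-defect bound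
`−C·Φ(x) ≤ Σ_{μ ≠ ν} t²[(Φ x − Φ(x−e_μ)) + (Φ x − Φ(x+e_μ))]` (product `cosh` weights: `C = 2t²Σ_{μ≠ν}(cosh a_μ − 1)`).  Then the weighted fibre sums
`h(s) = Σ_{x_ν = s} Φ(x)k(x)` satisfy `t²[(h(s) − h(s−1)) + (h(s) − h(s+1))] + (m − C)·h(s) ≤ Φ(0)·δ_{s,0}` on `ℤ∕N_ν` — so by
`B5Eq129FreeResolventCycleComparison.cycle_le_mul_of_subsolution` `h ≤ Φ(0)·φ_{m−C}` (`φ` the cycle resolvent), the transverse-decay input of the WEIGHTED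
∇-row (t4-ne9-idea-1 g129's `weighted_marginal_subsolution`, here on unequal periods in the (FS) encoding). [folklore] [cite: Balaban1984PropagatorsI, (1.29) p.23] -/
theorem weighted_fibreSum_subsolution (t m C : ℝ) {k Φ : Tor N → ℝ}
    (hk : ∀ x, ∑ ν, t ^ 2 * ((k x - k (x - unitVec N ν)) + (k x - k (x + unitVec N ν))) + m * k x = if x = 0 then 1 else 0)
    (hk0 : ∀ x, 0 ≤ k x) (ν : Fin d) (hΦν : ∀ x, Φ (x + unitVec N ν) = Φ x)
    (hCT : ∀ x, -(C * Φ x) ≤ ∑ μ ∈ Finset.univ.erase ν, t ^ 2 * ((Φ x - Φ (x - unitVec N μ)) + (Φ x - Φ (x + unitVec N μ))))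
    (s : ZMod (N ν)) :
    t ^ 2 * (((∑ x : Tor N, if x ν = s then Φ x * k x else 0) - ∑ x : Tor N, if x ν = s - 1 then Φ x * k x else 0) +
        ((∑ x : Tor N, if x ν = s then Φ x * k x else 0) - ∑ x : Tor N, if x ν = s + 1 then Φ x * k x else 0)) +
      (m - C) * (∑ x : Tor N, if x ν = s then Φ x * k x else 0) ≤ if s = 0 then Φ 0 else 0 := by
  classical
  -- pair the equation with `Φ·1_{x_ν = s}`
  have hsum : ∑ x : Tor N, (if x ν = s then Φ x *
      ((∑ μ, t ^ 2 * ((k x - k (x - unitVec N μ)) + (k x - k (x + unitVec N μ)))) + m * k x) else 0) =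
      ∑ x : Tor N, (if x ν = s then Φ x * (if x = 0 then (1 : ℝ) else 0) else 0) :=
    Finset.sum_congr rfl fun x _ => by rw [hk x]
  have hR : ∑ x : Tor N, (if x ν = s then Φ x * (if x = 0 then (1 : ℝ) else 0) else 0) = if s = 0 then Φ 0 else 0 := by
    rw [show (∑ x : Tor N, (if x ν = s then Φ x * (if x = 0 then (1 : ℝ) else 0) else 0)) =
        ∑ x : Tor N, (if x = 0 then (if x ν = s then Φ x else 0) else 0) from
      Finset.sum_congr rfl fun x _ => by split_ifs <;> simp, Finset.sum_ite_eq' Finset.univ (0 : Tor N)]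
    simp only [Finset.mem_univ, if_true, Pi.zero_apply]
    by_cases hs : s = 0
    · subst hs; simp
    · simp [hs, Ne.symm hs]
  -- expand the left-hand side: the ν-direction gives the longitudinal differences of `h`, the others the transverse stencil on `Φ`
  have e1 : ∀ x : Tor N, (if x ν = s then Φ x *
      ((∑ μ, t ^ 2 * ((k x - k (x - unitVec N μ)) + (k x - k (x + unitVec N μ)))) + m * k x) else 0) =
      ∑ μ, t ^ 2 * (if x ν = s then Φ x * ((k x - k (x - unitVec N μ)) + (k x - k (x + unitVec N μ))) else 0) +
        m * (if x ν = s then Φ x * k x else 0) := by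
    intro x
    split_ifs
    · rw [mul_add, Finset.mul_sum]
      congr 1
      · exact Finset.sum_congr rfl fun μ _ => by ring
      · ring
    · simp
  have hL : ∑ x : Tor N, (if x ν = s then Φ x *
      ((∑ μ, t ^ 2 * ((k x - k (x - unitVec N μ)) + (k x - k (x + unitVec N μ)))) + m * k x) else 0) =
      (∑ μ, t ^ 2 * ∑ x : Tor N, (if x ν = s then Φ x * ((k x - k (x - unitVec N μ)) + (k x - k (x + unitVec N μ))) else 0)) +
        m * ∑ x : Tor N, (if x ν = s then Φ x * k x else 0) := by
    rw [Finset.sum_congr rfl fun x _ => e1 x, Finset.sum_add_distrib, ← Finset.mul_sum, Finset.sum_comm]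
    simp only [← Finset.mul_sum]
  -- the ν-term
  have hν : ∑ x : Tor N, (if x ν = s then Φ x * ((k x - k (x - unitVec N ν)) + (k x - k (x + unitVec N ν))) else 0) =
      ((∑ x : Tor N, if x ν = s then Φ x * k x else 0) - ∑ x : Tor N, if x ν = s - 1 then Φ x * k x else 0) +
        ((∑ x : Tor N, if x ν = s then Φ x * k x else 0) - ∑ x : Tor N, if x ν = s + 1 then Φ x * k x else 0) := by
    have e : ∀ x : Tor N, (if x ν = s then Φ x * ((k x - k (x - unitVec N ν)) + (k x - k (x + unitVec N ν))) else 0) =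
        ((if x ν = s then Φ x * k x else 0) - (if x ν = s then Φ x * k (x - unitVec N ν) else 0)) +
          ((if x ν = s then Φ x * k x else 0) - (if x ν = s then Φ x * k (x + unitVec N ν) else 0)) := fun x => by
      split_ifs <;> ring
    simp only [e, Finset.sum_add_distrib, Finset.sum_sub_distrib, wfibre_sub_unitVec N k Φ ν hΦν, wfibre_add_unitVec N k Φ ν hΦν]
  -- the transverse terms, moved onto `Φ` and bounded below by `−C·h(s)`
  have hT : -(C * ∑ x : Tor N, (if x ν = s then Φ x * k x else 0)) ≤
      ∑ μ ∈ Finset.univ.erase ν, t ^ 2 * ∑ x : Tor N,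
        (if x ν = s then Φ x * ((k x - k (x - unitVec N μ)) + (k x - k (x + unitVec N μ))) else 0) := by
    have e0 : ∑ μ ∈ Finset.univ.erase ν, t ^ 2 * ∑ x : Tor N,
        (if x ν = s then Φ x * ((k x - k (x - unitVec N μ)) + (k x - k (x + unitVec N μ))) else 0) =
        ∑ μ ∈ Finset.univ.erase ν, t ^ 2 * ∑ x : Tor N,
        (if x ν = s then k x * ((Φ x - Φ (x - unitVec N μ)) + (Φ x - Φ (x + unitVec N μ))) else 0) :=
      Finset.sum_congr rfl fun μ hμ => by rw [fibre_sum_mul_transverse_comm N k Φ (Finset.ne_of_mem_erase hμ) s]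
    -- swap the sums: `Σ_μ t² Σ_x 1_s k·(…Φ…) = Σ_x 1_s k·Σ_μ t²(…Φ…) ≥ Σ_x 1_s k·(−C Φ)`
    have e : ∑ μ ∈ Finset.univ.erase ν, t ^ 2 * ∑ x : Tor N,
        (if x ν = s then k x * ((Φ x - Φ (x - unitVec N μ)) + (Φ x - Φ (x + unitVec N μ))) else 0) =
        ∑ x : Tor N, (if x ν = s then k x * ∑ μ ∈ Finset.univ.erase ν,
          t ^ 2 * ((Φ x - Φ (x - unitVec N μ)) + (Φ x - Φ (x + unitVec N μ))) else 0) := by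
      simp only [Finset.mul_sum]
      rw [Finset.sum_comm]
      refine Finset.sum_congr rfl fun x _ => ?_
      split_ifs
      · exact Finset.sum_congr rfl fun μ _ => by ring
      · simp
    rw [e0, e, Finset.mul_sum, ← Finset.sum_neg_distrib]
    refine Finset.sum_le_sum fun x _ => ?_
    split_ifs
    · have := mul_le_mul_of_nonneg_left (hCT x) (hk0 x)
      linarith
    · simp
  -- assemble
  have htot := hsum
  rw [hL, hR, ← Finset.add_sum_erase Finset.univ _ (Finset.mem_univ ν), hν] at htot
  linarith [htot, hT]

/-! ## §2 The weighted transverse collapse: one sign per fibre ⟹ the weighted row is a weighted total variation of the weighted profile -/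

/-- **WEIGHTED TRANSVERSE COLLAPSE.**  For a transverse weight `Φ ≥ 0` that does not see `x_ν`, ANY longitudinal weight `w : ℤ∕N_ν → ℝ`, and a
lattice function `k` whose dipole `k(· − e_ν) − k` has ONE sign on every fibre `{x_ν = s}` (the free resolvent kernel:
`B5Eq129FreeResolventKernelMonotone.dipole_sign_on_fibre`): `Σ_x w(x_ν)Φ(x)|k(x − e_ν) − k(x)| = Σ_s w(s)|h(s−1) − h(s)|`, `h(s) = Σ_{x_ν = s} Φ(x)k(x)` —
the weighted twin of `B5Eq129FreeResolventFibreCollapse.sum_abs_sub_eq_sum_abs_fibreSum_sub`. [folklore] [cite: Balaban1984PropagatorsI, (1.29) p.23] -/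
theorem weighted_sum_abs_sub_eq (k Φ : Tor N → ℝ) (ν : Fin d) (hΦ0 : ∀ x, 0 ≤ Φ x) (hΦν : ∀ x, Φ (x + unitVec N ν) = Φ x)
    (w : ZMod (N ν) → ℝ)
    (hsign : ∀ s : ZMod (N ν), (∀ x : Tor N, x ν = s → 0 ≤ k (x - unitVec N ν) - k x) ∨
      (∀ x : Tor N, x ν = s → k (x - unitVec N ν) - k x ≤ 0)) :
    ∑ x : Tor N, w (x ν) * Φ x * |k (x - unitVec N ν) - k x| =
      ∑ s : ZMod (N ν), w s * |(∑ x : Tor N, if x ν = s - 1 then Φ x * k x else 0) - ∑ x : Tor N, if x ν = s then Φ x * k x else 0| := by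
  classical
  -- decompose over the fibres of `x ↦ x_ν`
  have h2 : ∑ x : Tor N, w (x ν) * Φ x * |k (x - unitVec N ν) - k x| =
      ∑ s : ZMod (N ν), ∑ x : Tor N, (if x ν = s then w s * (Φ x * |k (x - unitVec N ν) - k x|) else 0) := by
    rw [Finset.sum_comm]
    refine Finset.sum_congr rfl fun x _ => ?_
    rw [Finset.sum_ite_eq Finset.univ (x ν)]; simp [mul_assoc]
  rw [h2]
  refine Finset.sum_congr rfl fun s _ => ?_
  have e : ∀ x : Tor N, (if x ν = s then w s * (Φ x * |k (x - unitVec N ν) - k x|) else 0) =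
      w s * (if x ν = s then Φ x * |k (x - unitVec N ν) - k x| else 0) := fun x => by split_ifs <;> simp
  rw [Finset.sum_congr rfl (fun x _ => e x), ← Finset.mul_sum]
  congr 1
  -- one sign per fibre: the weighted absolute values sum inside
  have hdiff : (∑ x : Tor N, if x ν = s - 1 then Φ x * k x else 0) - (∑ x : Tor N, if x ν = s then Φ x * k x else 0) =
      ∑ x : Tor N, (if x ν = s then Φ x * (k (x - unitVec N ν) - k x) else 0) := by
    rw [← wfibre_sub_unitVec N k Φ ν hΦν s, ← Finset.sum_sub_distrib]
    exact Finset.sum_congr rfl fun x _ => by split_ifs <;> ring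
  rw [hdiff]
  rcases hsign s with h | h
  · have hterm : ∀ x : Tor N, (if x ν = s then Φ x * |k (x - unitVec N ν) - k x| else 0) =
        (if x ν = s then Φ x * (k (x - unitVec N ν) - k x) else 0) := fun x => by
      split_ifs with hx
      · rw [abs_of_nonneg (h x hx)]
      · rfl
    rw [Finset.sum_congr rfl fun x _ => hterm x, abs_of_nonneg]
    exact Finset.sum_nonneg fun x _ => by
      split_ifs with hx
      · exact mul_nonneg (hΦ0 x) (h x hx)
      · exact le_rfl
  · have hterm : ∀ x : Tor N, (if x ν = s then Φ x * |k (x - unitVec N ν) - k x| else 0) =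
        -(if x ν = s then Φ x * (k (x - unitVec N ν) - k x) else 0) := fun x => by
      split_ifs with hx
      · rw [abs_of_nonpos (h x hx)]; ring
      · simp
    rw [Finset.sum_congr rfl fun x _ => hterm x, Finset.sum_neg_distrib, abs_of_nonpos]
    exact Finset.sum_nonpos fun x _ => by
      split_ifs with hx
      · exact mul_nonpos_iff.2 (Or.inl ⟨hΦ0 x, h x hx⟩)
      · exact le_rfl

/-! ## §3 The ν-free product weight satisfies the three weight hypotheses -/

omit [∀ μ, NeZero (N μ)] in
/-- **THE ν-FREE PRODUCT WEIGHT**: for one-dimensional factors `ψ_μ > 0` with the stencil bound `ψ_μ(y+1) + ψ_μ(y−1) ≤ 2cosh(a_μ)·ψ_μ(y)` (the periodic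
`cosh(a·d_N(y))` weights: `B5G183FreeRowSum.cosh_circAbs_step`), the transverse weight `Φ(x) = Π_{μ ≠ ν} ψ_μ(x_μ)` does not read `x_ν` and has the
transverse supersolution defect `C = 2t²Σ_{μ≠ν}(cosh a_μ − 1)` — the three weight hypotheses of `weighted_fibreSum_subsolution` ∕
`B5Eq129FreeResolventWeightedGradientRow.weighted_sum_abs_sub_le` (t4-ne9-idea-1 g129's `transverse_weight_supersolution`). [folklore]
[cite: Balaban1984PropagatorsI, (1.29) p.23] -/
theorem prod_weight_transverse_defect (t : ℝ) (ν : Fin d) (ψ : (μ : Fin d) → ZMod (N μ) → ℝ) (hpos : ∀ μ y, 0 < ψ μ y) (a : Fin d → ℝ)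
    (hst : ∀ μ y, ψ μ (y + 1) + ψ μ (y - 1) ≤ 2 * Real.cosh (a μ) * ψ μ y) (x : Tor N) :
    -((2 * t ^ 2 * ∑ μ ∈ Finset.univ.erase ν, (Real.cosh (a μ) - 1)) * ∏ μ ∈ Finset.univ.erase ν, ψ μ (x μ)) ≤
      ∑ μ ∈ Finset.univ.erase ν, t ^ 2 * (((∏ κ ∈ Finset.univ.erase ν, ψ κ (x κ)) - ∏ κ ∈ Finset.univ.erase ν, ψ κ ((x - unitVec N μ) κ)) +
        ((∏ κ ∈ Finset.univ.erase ν, ψ κ (x κ)) - ∏ κ ∈ Finset.univ.erase ν, ψ κ ((x + unitVec N μ) κ))) := by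
  classical
  rw [Finset.mul_sum, Finset.sum_mul, ← Finset.sum_neg_distrib]
  refine Finset.sum_le_sum fun μ hμ => ?_
  -- split off the factor `μ`
  set E := (Finset.univ.erase ν).erase μ with hE
  have hsplit : ∀ z : Tor N, ∏ κ ∈ Finset.univ.erase ν, ψ κ (z κ) = ψ μ (z μ) * ∏ κ ∈ E, ψ κ (z κ) := fun z =>
    (Finset.mul_prod_erase _ (fun κ => ψ κ (z κ)) hμ).symm
  have hrest : ∀ (z : Tor N), (∀ κ ∈ E, z κ = x κ) → ∏ κ ∈ E, ψ κ (z κ) = ∏ κ ∈ E, ψ κ (x κ) := fun z hz =>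
    Finset.prod_congr rfl fun κ hκ => by rw [hz κ hκ]
  have hm : ∏ κ ∈ E, ψ κ ((x - unitVec N μ) κ) = ∏ κ ∈ E, ψ κ (x κ) :=
    hrest _ fun κ hκ => by simp [unitVec, Pi.single_eq_of_ne (Finset.ne_of_mem_erase hκ)]
  have hp : ∏ κ ∈ E, ψ κ ((x + unitVec N μ) κ) = ∏ κ ∈ E, ψ κ (x κ) :=
    hrest _ fun κ hκ => by simp [unitVec, Pi.single_eq_of_ne (Finset.ne_of_mem_erase hκ)]
  have hμm : (x - unitVec N μ) μ = x μ - 1 := by simp [unitVec]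
  have hμp : (x + unitVec N μ) μ = x μ + 1 := by simp [unitVec]
  rw [hsplit x, hsplit (x - unitVec N μ), hsplit (x + unitVec N μ), hm, hp, hμm, hμp]
  have hP : 0 ≤ ∏ κ ∈ E, ψ κ (x κ) := Finset.prod_nonneg fun κ _ => (hpos κ _).le
  have h1 := hst μ (x μ)
  have ht : 0 ≤ t ^ 2 := sq_nonneg t
  nlinarith [mul_le_mul_of_nonneg_left h1 (mul_nonneg ht hP)]

omit [∀ μ, NeZero (N μ)] in
/-- the ν-free product weight does not read `x_ν` (shift). [folklore] [cite: Balaban1984PropagatorsI, (1.29) p.23] -/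
theorem prod_weight_add_unitVec (ν : Fin d) (ψ : (μ : Fin d) → ZMod (N μ) → ℝ) (x : Tor N) :
    ∏ κ ∈ Finset.univ.erase ν, ψ κ ((x + unitVec N ν) κ) = ∏ κ ∈ Finset.univ.erase ν, ψ κ (x κ) :=
  Finset.prod_congr rfl fun κ hκ => by simp [unitVec, Pi.single_eq_of_ne (Finset.ne_of_mem_erase hκ)]

omit [∀ μ, NeZero (N μ)] in
/-- the ν-free product weight does not read `x_ν` (reflection). [folklore] [cite: Balaban1984PropagatorsI, (1.29) p.23] -/
theorem prod_weight_reflect (ν : Fin d) (ψ : (μ : Fin d) → ZMod (N μ) → ℝ) (x : Tor N) :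
    ∏ κ ∈ Finset.univ.erase ν, ψ κ ((Function.update x ν (-x ν)) κ) = ∏ κ ∈ Finset.univ.erase ν, ψ κ (x κ) :=
  Finset.prod_congr rfl fun κ hκ => by rw [Function.update_of_ne (Finset.ne_of_mem_erase hκ)]

end Literature.MathematicalPhysics.QuantumFieldTheory.Balaban1983to89.B5Eq129FreeResolventWeightedMarginal

end
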